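import Summits.AtomisticToContinuum.BoseEinsteinCondensation.Theorems.GaussianDominationCan.Negative.CruxForms
import Summits.AtomisticToContinuum.BoseEinsteinCondensation.Theorems.GaussianDominationCan.Negative.StructureII
import Literature.MathematicalPhysics.QuantumManyBody.OneBodyCurrentGain
import HarnessLib

/-!
# Stub A3 `stub_freeAnchorOf` — the free-gas Gaussian-domination chord from its two analytic inputs

Crux `GaussianDominationCan` (`stmt-AtomisticToContinuum-9479`, route `BECThomsonPrinciple`), line
`coupling-monotone-chord`, stub A3 of the checked skeleton
`Cruxes/GaussianDominationCan/Lines/coupling-monotone-chord.lean`.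

For the FREE gas (`v = 0`) the chord (Gaussian-domination) inequality
`E₀(0) + s·2N|I(Φ)| ≤ E₀(Φ) + (1/(4π²)) s² L²/‖n‖∞²` holds for every `N = m + 1`, `L > 0`, `n ≠ 0`,
`s ≥ 0` and every periodic Bose trial state `Φ`, GIVEN the two analytic inputs of the line (the
neighbouring stubs A1, A2, taken here as hypotheses and NOT proved):
* A1 (one-mode gradient Bessel inequality) `N|k|² ∫_{cell^N} |ĉ_k|² ≤ T(Φ)`, where
  `ĉ_k = P₀(conj(e^{ik·x₀}) Φ)` is the `k`-mode coefficient of particle `0` given the bath;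
* A2 (Bose counting) `N ∫_{cell^N} |Θ|² ≤ 1`, `Θ = Σ_{S∋0} |S|^{-1/2} Q_S Φ`.

Proof.  `E₀(0) = 0` (the constant state, `Negative.periodicEnergy_constState`); `Θ` does not depend
on `x₀` (`Negative.theta_update_zero`), so `P₀Θ = Θ`, and by the self-adjointness of `P₀` on
continuous functions (`Negative.integral_conj_mul_cellAvg`) the source is `I = ∫ conj(ĉ_k)·Θ`;
Cauchy–Schwarz in `ℝ≥0∞` gives `(N|I|)² ≤ (N∫|ĉ_k|²)(N∫|Θ|²) ≤ T·L²/(4π² Σⱼ nⱼ²) ≤ (1/(4π²))(L²/‖n‖∞²)·T`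
(`‖n‖∞² ≤ Σⱼ nⱼ²`), and this square (susceptibility) form is equivalent to the chord for all
`s ≥ 0` (`Negative.forall_gdIneq_iff`).

References: E. H. Lieb, R. Seiringer, J. P. Solovej, J. Yngvason, *The Mathematics of the Bose Gas
and its Condensation* (2005), App. A; M. Lewin, P. T. Nam, S. Serfaty, J. P. Solovej,
*Comm. Pure Appl. Math.* 68 (2015) 413 (the excitation map).  All statements here are [folklore].
-/

noncomputable section

namespace Summit.AtomisticToContinuum.BoseEinsteinCondensation.Cruxes.GaussianDominationCan.CouplingMonotoneChord

open MeasureTheory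
open scoped ENNReal NNReal ComplexConjugate
open Literature.MathematicalPhysics.QuantumManyBody.BoseGas
open Summit.AtomisticToContinuum.BoseEinsteinCondensation.Theorems.GaussianDominationCan.Negative

/-! ## Helper lemmas (private) -/

/-- The free periodic ground-state energy vanishes: the constant state `L^{-3N/2}` has zero free
energy and energies are non-negative. [folklore] -/
private theorem periodicGroundStateEnergy_free {L : ℝ} (hL : 0 < L) (m : ℕ) :
    periodicGroundStateEnergy 0 (m + 1) L = 0 := by
  have hc : ((Real.sqrt (L ^ 3))⁻¹) ^ 2 * L ^ 3 = 1 := by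
    rw [inv_pow, Real.sq_sqrt (by positivity)]
    exact inv_mul_cancel₀ (by positivity)
  exact le_antisymm ((periodicGroundStateEnergy_le 0 (constState m hL _ hc)).trans
    (periodicEnergy_constState hL hc).le) zero_le

/-- The crux's phase `e^{ik·x₀}` is continuous on configuration space. [folklore] -/
private theorem continuous_phase' (m : ℕ) (L : ℝ) (n : Fin 3 → ℤ) : Continuous (phase m L n) := by
  have h : phase m L n = fun X => cellWave L n (X 0) := funext (phase_eq_cellWave m L n)
  rw [h]
  exact (contDiff_cellWave L n).continuous.comp (continuous_apply 0)

/-- The crux's `foldr` of cell averages / fluctuations preserves continuity. [folklore] -/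
private theorem continuous_foldr_cellAvg {N : ℕ} {L : ℝ} (S : Finset (Fin N)) {g : Config N → ℂ}
    (hg : Continuous g) (l : List (Fin N)) :
    Continuous (l.foldr (fun i h => if i ∈ S then cellAvg N L i h else h - cellAvg N L i h) g) := by
  induction l with
  | nil => exact hg
  | cons a l ih =>
    rw [List.foldr_cons]
    split_ifs
    · exact continuous_cellAvg a ih
    · exact ih.sub (continuous_cellAvg a ih)

/-- `Q_S g` is continuous for continuous `g`. [folklore] -/
private theorem continuous_modeProj' {N : ℕ} {L : ℝ} (S : Finset (Fin N)) {g : Config N → ℂ}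
    (hg : Continuous g) : Continuous (modeProj N L S g) :=
  continuous_foldr_cellAvg S hg _

/-- `Θ = Σ_{S∋0} |S|^{-1/2} Q_S ψ` is continuous for continuous `ψ`. [folklore] -/
private theorem continuous_theta' (m : ℕ) (L : ℝ) {ψ : Config (m + 1) → ℂ} (hψ : Continuous ψ) :
    Continuous (theta m L ψ) := by
  unfold theta
  exact continuous_finsetSum _ fun S _ => continuous_const.mul (continuous_modeProj' S hψ)

/-- `P₀ Θ = Θ`: `Θ` does not depend on `x₀` and `∫_cell 1 = L³`. [folklore] -/
private theorem cellAvg_zero_theta {m : ℕ} {L : ℝ} (hL : 0 < L) (ψ : Config (m + 1) → ℂ) :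
    cellAvg (m + 1) L 0 (theta m L ψ) = theta m L ψ := by
  funext X
  show ((L ^ 3)⁻¹ : ℝ) • ∫ y in cell L, theta m L ψ (Function.update X 0 y) = _
  simp_rw [theta_update_zero]
  rw [integral_cell_const hL, Complex.real_smul, ← mul_assoc]
  have hL' : (L : ℂ) ≠ 0 := by exact_mod_cast hL.ne'
  rw [show (((L ^ 3)⁻¹ : ℝ) : ℂ) * (L : ℂ) ^ 3 = 1 by
    rw [Complex.ofReal_inv, Complex.ofReal_pow, inv_mul_cancel₀ (pow_ne_zero 3 hL')], one_mul]

/-- **The source through the mode coefficient**: `I(ψ) = ∫ conj(ĉ_k)·Θ` with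
`ĉ_k = P₀(conj(e^{ik·x₀}) ψ)` (self-adjointness of `P₀` and `P₀Θ = Θ`). [folklore] -/
private theorem sourceIntegral_eq_integral_conj_modeCoeff {m : ℕ} {L : ℝ} (hL : 0 < L)
    (n : Fin 3 → ℤ) {ψ : Config (m + 1) → ℂ} (hψ : Continuous ψ) :
    sourceIntegral m L n ψ =
      ∫ X in cellN (m + 1) L,
        conj (cellAvg (m + 1) L 0 (fun Y => conj (phase m L n Y) * ψ Y) X) * theta m L ψ X := by
  have hg : Continuous fun Y => conj (phase m L n Y) * ψ Y :=
    (Complex.continuous_conj.comp (continuous_phase' m L n)).mul hψ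
  rw [← integral_conj_mul_cellAvg 0 hg (continuous_theta' m L hψ), cellAvg_zero_theta hL]
  unfold sourceIntegral
  refine integral_congr_ae (Filter.Eventually.of_forall fun X => ?_)
  show conj (ψ X) * phase m L n X * theta m L ψ X =
    conj (conj (phase m L n X) * ψ X) * theta m L ψ X
  rw [map_mul, Complex.conj_conj]
  ring

/-- **Cauchy–Schwarz** on `cell^N` in `ℝ≥0∞`: `‖∫ conj(f)·g‖² ≤ (∫|f|²)(∫|g|²)` for continuous
`f`, `g`. [folklore] -/
private theorem enorm_integral_conj_mul_sq_le {N : ℕ} {L : ℝ} {f g : Config N → ℂ}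
    (hf : Continuous f) (hg : Continuous g) :
    ‖∫ X in cellN N L, conj (f X) * g X‖ₑ ^ 2 ≤
      (∫⁻ X in cellN N L, (‖f X‖₊ : ℝ≥0∞) ^ 2) * ∫⁻ X in cellN N L, (‖g X‖₊ : ℝ≥0∞) ^ 2 := by
  set μ : Measure (Config N) := (volume : Measure (Config N)).restrict (cellN N L)
  have h1 : ‖∫ X, conj (f X) * g X ∂μ‖ₑ ≤ ∫⁻ X, ‖f X‖ₑ * ‖g X‖ₑ ∂μ := by
    refine (enorm_integral_le_lintegral_enorm _).trans (lintegral_mono fun X => ?_)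
    rw [enorm_mul, RCLike.enorm_conj]
  have h2 : ∫⁻ X, ‖f X‖ₑ * ‖g X‖ₑ ∂μ ≤
      (∫⁻ X, ‖f X‖ₑ ^ 2 ∂μ) ^ (1 / 2 : ℝ) * (∫⁻ X, ‖g X‖ₑ ^ 2 ∂μ) ^ (1 / 2 : ℝ) := by
    have h := ENNReal.lintegral_mul_le_Lp_mul_Lq μ Real.HolderConjugate.two_two
      hf.aestronglyMeasurable.enorm hg.aestronglyMeasurable.enorm
    simpa only [Pi.mul_apply, ENNReal.rpow_two, one_div] using h
  calc ‖∫ X, conj (f X) * g X ∂μ‖ₑ ^ 2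
      ≤ ((∫⁻ X, ‖f X‖ₑ ^ 2 ∂μ) ^ (1 / 2 : ℝ) * (∫⁻ X, ‖g X‖ₑ ^ 2 ∂μ) ^ (1 / 2 : ℝ)) ^ 2 := by
        gcongr
        exact h1.trans h2
    _ = (∫⁻ X, ‖f X‖ₑ ^ 2 ∂μ) * ∫⁻ X, ‖g X‖ₑ ^ 2 ∂μ := by
        rw [mul_pow, ← ENNReal.rpow_two, ← ENNReal.rpow_two, ← ENNReal.rpow_mul,
          ← ENNReal.rpow_mul]
        norm_num

/-- `‖n‖∞² ≤ Σⱼ nⱼ²` for the sup norm of the real vector `(nⱼ)`. [folklore] -/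
private theorem norm_sq_le_nsq (n : Fin 3 → ℤ) : ‖(fun j => (n j : ℝ))‖ ^ 2 ≤ nsq n := by
  have hle : ‖(fun j => (n j : ℝ))‖ ≤ Real.sqrt (nsq n) := by
    refine (pi_norm_le_iff_of_nonneg (Real.sqrt_nonneg _)).mpr fun j => ?_
    refine (Real.le_sqrt (norm_nonneg _) (nsq_nonneg n)).mpr ?_
    rw [Real.norm_eq_abs, sq_abs]
    exact Finset.single_le_sum (f := fun j => (n j : ℝ) ^ 2) (fun j _ => sq_nonneg _)
      (Finset.mem_univ j)
  exact (Real.le_sqrt (norm_nonneg _) (nsq_nonneg n)).mp hle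

/-! ## The stub -/

/-- **Stub A3 `stub_freeAnchorOf`** — the free anchor of the line `coupling-monotone-chord` from its
two analytic inputs: IF the one-mode gradient Bessel inequality `N|k|²∫|ĉ_k|² ≤ T` (A1) and the Bose
counting bound `N∫|Θ|² ≤ 1` (A2) hold, THEN for the free gas the Gaussian-domination chord
`E₀(0) + s·2N|I(Φ)| ≤ E₀(Φ) + (1/(4π²)) s² L²/‖n‖∞²` holds for every `N = m+1`, `L > 0`, `n ≠ 0`,
`s ≥ 0` and every periodic Bose trial state (`E₀(0) = 0`, `I = ∫ conj(ĉ_k)Θ`, Cauchy–Schwarz,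
`‖n‖∞² ≤ Σⱼnⱼ²`, chord ⇔ square). [folklore] -/
theorem stub_freeAnchorOf :
    (∀ m : ℕ, ∀ L : ℝ, 0 < L → ∀ n : Fin 3 → ℤ, ∀ Φ : PeriodicTrialState (m + 1) L,
      ENNReal.ofReal ((m + 1 : ℝ) * (4 * Real.pi ^ 2 * nsq n / L ^ 2)) *
          ∫⁻ X in cellN (m + 1) L,
            (‖cellAvg (m + 1) L 0 (fun Y => (starRingEnd ℂ) (phase m L n Y) * Φ.ψ Y) X‖₊ : ℝ≥0∞) ^ 2 ≤
        ∫⁻ X in cellN (m + 1) L, kineticDensity Φ.ψ X) →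
    (∀ m : ℕ, ∀ L : ℝ, 0 < L → ∀ Φ : PeriodicTrialState (m + 1) L,
      ((m + 1 : ℕ) : ℝ≥0∞) * ∫⁻ X in cellN (m + 1) L, (‖theta m L Φ.ψ X‖₊ : ℝ≥0∞) ^ 2 ≤ 1) →
    ∀ m : ℕ, ∀ L : ℝ, 0 < L → ∀ n : Fin 3 → ℤ, n ≠ 0 → ∀ s : ℝ, 0 ≤ s →
      ∀ Φ : PeriodicTrialState (m + 1) L, GDIneq 0 m L n (1 / (4 * Real.pi ^ 2)) s Φ := by
  intro hA1 hA2 m L hL n hn s hs Φ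
  have hC : (0 : ℝ) < 1 / (4 * Real.pi ^ 2) := by positivity
  refine (forall_gdIneq_iff hC hL hn Φ).mpr ?_ s hs
  intro htop
  rw [periodicGroundStateEnergy_free hL m, tsub_zero]
  -- names
  set nv : Fin 3 → ℝ := fun j => (n j : ℝ) with hnv
  set T : ℝ≥0∞ := periodicEnergy 0 Φ with hT
  set I : ℂ := sourceIntegral m L n Φ.ψ with hI
  set A : ℝ≥0∞ := ∫⁻ X in cellN (m + 1) L,
    (‖cellAvg (m + 1) L 0 (fun Y => conj (phase m L n Y) * Φ.ψ Y) X‖₊ : ℝ≥0∞) ^ 2 with hA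
  set B : ℝ≥0∞ := ∫⁻ X in cellN (m + 1) L, (‖theta m L Φ.ψ X‖₊ : ℝ≥0∞) ^ 2 with hB
  set κ : ℝ := 4 * Real.pi ^ 2 * nsq n / L ^ 2 with hκ
  -- the integer vector: `1 ≤ ‖n‖∞`, `‖n‖∞² ≤ Σ nⱼ²`
  have hnvpos : 0 < ‖nv‖ := one_pos.trans_le (one_le_norm_intVec hn)
  have hnsq : ‖nv‖ ^ 2 ≤ nsq n := norm_sq_le_nsq n
  have hnsqpos : 0 < nsq n := lt_of_lt_of_le (by positivity) hnsq
  have hκpos : 0 < κ := by positivity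
  -- the two inputs at this data
  have hkin : ∫⁻ X in cellN (m + 1) L, kineticDensity Φ.ψ X = T := by
    rw [hT]
    unfold periodicEnergy
    simp only [periodicInteraction_zero, zero_mul, add_zero]
  have h1 : ENNReal.ofReal κ * ((m : ℝ≥0∞) + 1) * A ≤ T := by
    have h := hA1 m L hL n Φ
    rw [hkin, ENNReal.ofReal_mul (by positivity), ← Nat.cast_succ, ENNReal.ofReal_natCast] at h
    calc ENNReal.ofReal κ * ((m : ℝ≥0∞) + 1) * A
        = ((m + 1 : ℕ) : ℝ≥0∞) * ENNReal.ofReal κ * A := by push_cast; ring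
      _ ≤ T := h
  have h2 : ((m : ℝ≥0∞) + 1) * B ≤ 1 := by
    have h := hA2 m L hL Φ
    push_cast at h
    exact h
  -- Cauchy–Schwarz for the source written through the mode coefficient
  have hCS : ‖I‖ₑ ^ 2 ≤ A * B := by
    rw [hI, sourceIntegral_eq_integral_conj_modeCoeff hL n Φ.contDiff.continuous]
    exact enorm_integral_conj_mul_sq_le
      (continuous_cellAvg 0 ((Complex.continuous_conj.comp (continuous_phase' m L n)).mul
        Φ.contDiff.continuous))
      (continuous_theta' m L Φ.contDiff.continuous)
  -- assemble in `ℝ≥0∞`: `κ (N|I|)² ≤ (κ N ∫|ĉ|²)(N ∫|Θ|²) ≤ T · 1`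
  have hkey : ENNReal.ofReal κ * (((m : ℝ≥0∞) + 1) ^ 2 * ‖I‖ₑ ^ 2) ≤ T := by
    calc ENNReal.ofReal κ * (((m : ℝ≥0∞) + 1) ^ 2 * ‖I‖ₑ ^ 2)
        ≤ ENNReal.ofReal κ * (((m : ℝ≥0∞) + 1) ^ 2 * (A * B)) := by gcongr
      _ = (ENNReal.ofReal κ * ((m : ℝ≥0∞) + 1) * A) * (((m : ℝ≥0∞) + 1) * B) := by ring
      _ ≤ T * 1 := mul_le_mul' h1 h2
      _ = T := mul_one T
  -- pass to real numbers (`T < ∞`)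
  have hreal : κ * (((m : ℝ) + 1) * ‖I‖) ^ 2 ≤ T.toReal := by
    have hlhs : ENNReal.ofReal (κ * (((m : ℝ) + 1) * ‖I‖) ^ 2) =
        ENNReal.ofReal κ * (((m : ℝ≥0∞) + 1) ^ 2 * ‖I‖ₑ ^ 2) := by
      rw [ENNReal.ofReal_mul hκpos.le, ENNReal.ofReal_pow (by positivity),
        ENNReal.ofReal_mul (by positivity), mul_pow, ofReal_norm, ← Nat.cast_succ,
        ENNReal.ofReal_natCast, Nat.cast_succ]
    rw [← ENNReal.ofReal_le_ofReal_iff ENNReal.toReal_nonneg, hlhs, ENNReal.ofReal_toReal htop]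
    exact hkey
  -- the constant: `4π²‖n‖∞²/L² ≤ κ`
  have hfin : (((m : ℝ) + 1) * ‖I‖) ^ 2 * (4 * Real.pi ^ 2 * ‖nv‖ ^ 2 / L ^ 2) ≤ T.toReal := by
    calc (((m : ℝ) + 1) * ‖I‖) ^ 2 * (4 * Real.pi ^ 2 * ‖nv‖ ^ 2 / L ^ 2)
        ≤ (((m : ℝ) + 1) * ‖I‖) ^ 2 * κ := by rw [hκ]; gcongr
      _ ≤ T.toReal := by rw [mul_comm]; exact hreal
  have hLne : L ≠ 0 := hL.ne'
  have hnvne : ‖nv‖ ≠ 0 := hnvpos.ne'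
  have hpi : Real.pi ≠ 0 := Real.pi_ne_zero
  calc (((m : ℝ) + 1) * ‖I‖) ^ 2
      = (((m : ℝ) + 1) * ‖I‖) ^ 2 * (4 * Real.pi ^ 2 * ‖nv‖ ^ 2 / L ^ 2) *
          (1 / (4 * Real.pi ^ 2) * L ^ 2 / ‖nv‖ ^ 2) := by field_simp
    _ ≤ T.toReal * (1 / (4 * Real.pi ^ 2) * L ^ 2 / ‖nv‖ ^ 2) := by gcongr
    _ = 1 / (4 * Real.pi ^ 2) * L ^ 2 / ‖nv‖ ^ 2 * T.toReal := mul_comm _ _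

end Summit.AtomisticToContinuum.BoseEinsteinCondensation.Cruxes.GaussianDominationCan.CouplingMonotoneChord

end
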